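import Summits.BirchSwinnertonDyer.BirchSwinnertonDyer.Theorems.DerivedKatoValuationDoorIntegralH1RankLeTwoOfAnalyticRankTwoIffSelCapModPrint
import Summits.BirchSwinnertonDyer.BirchSwinnertonDyer.Theorems.DerivedKatoValuationDoorIntegralH1RankLeTwoOfAnalyticRankTwoRungOfFacts
import Summits.BirchSwinnertonDyer.BirchSwinnertonDyer.Theses.SelmerRank
import Summits.BirchSwinnertonDyer.BirchSwinnertonDyer.Theses.PAdicOrderV2
import Literature.NumberTheory.EllipticCurves.BSDSelmer
import Literature.NumberTheory.EllipticCurves.BSDSelmerPConverseRankZeroOrdinaryProofs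
import Literature.NumberTheory.EllipticCurves.NonEisensteinPrimeOfSurjective
import Literature.NumberTheory.EllipticCurves.ComplexMultiplication
import HarnessLib

/-!
# TRANSFER certificate for the research stub N1∣_door of the (β) crux S2 `IntegralH1RankLeTwoOfAnalyticRankTwo`
# (stmt-BirchSwinnertonDyer-23752, line `birth`, stub `stub_selCapTwoAtDoorOfAnalyticRankTwo`; LEAD bsd-line-dkd-p1 g4 —
# strategist lenses TRANSFER / STRENGTHEN / NEGATION; helper, closes nothing)

N1∣_door is «for every globally minimal `E/ℚ` of analytic rank two and every door prime `p` (`5 ≤ p`, good ordinary,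
`ρ̄_{E,p}` onto): `corank_{ℤ_p} Sel_{p^∞}(E/ℚ) ≤ 2`».  This file places it BY NAME among the EXISTING items of the tree
and records what parity and the rank-zero `p`-converse say about it.

* §1 TRANSFER DOWN (unconditional, by name): N1∣_door ⟸ `SelmerRank.SelmerRankUB` (stmt-BirchSwinnertonDyer-0130, `s_p ≤
  a` at big-image good ordinary `p ≥ 5`; N1∣_door is LITERALLY its `a = 2` slice, `selCapTwoAtDoor_of_selmerRankUB`) and
  N1∣_door ⟸ `SelmerRank.SelmerRankRankTwo` (stmt-BirchSwinnertonDyer-0129, `s_p = 2 ↔ a = 2`; its ← half,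
  `selCapTwoAtDoor_of_selmerRankRankTwo`); the R2 copies 0484 / 0483 are `Iff.rfl`-equal.  Hence the crux S2 BY NAME from
  either item modulo {dictionary, [KP07 1.4], `PointsTwo`} (`integralH1RankLeTwoOfAnalyticRankTwo_of_selmerRankUB_of_facts`,
  `…_of_selmerRankRankTwo_of_facts`), and `SelmerRankUB` ALONE gives the route's non-CM Tate face at `a = 2`
  (`mordellWeilRank_le_two_of_selmerRankUB`).
* §2 TRANSFER DOWN from the `p`-adic order node: N1∣_door ⟸ `PAdicOrderV2.PAdicOrderComparisonR2` (stmt-BirchSwinnertonDyer-0489,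
  `ord_T L_p(f, α_p) = a` at good ordinary `p`) modulo {Kato Thm. 18.4, modularity} (`selCapTwoAtDoor_of_pAdicOrderComparisonR2_of_facts`,
  through g3's `selCapTwoAtDoor_of_ordCapTwoAtDoor_of_facts`).
* §3 STRENGTHEN / NEGATION by PARITY (modulo the `p`-parity fact `selmerCorank_mod_two_eq`, Dokchitser–Dokchitser 2010 Thm 1.4):
  at an `a = 2` cell `s_p` is even, so N1∣_door is EQUIVALENT to the a-priori weaker «`s_p ≤ 3`»
  (`selCapTwoAtDoor_iff_selCapThreeAtDoor_of_parity`) and a failure overshoots to `s_p ≥ 4`, i.e. `rank E(ℚ) + corank Ш[p^∞] ≥ 4`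
  at a door prime of an analytic-rank-two curve (`not_selCapTwoAtDoor_iff_of_parity`) — which is ALSO a failure of `SelmerRankUB`
  on its first open cell (contrapositive of §1; cf. `Theorems/SelmerRankUB/Negative/CounterexampleProfile.lean`).
* §4 EXACTNESS (modulo {modularity, Mazur's main conjecture in `Λ ⊗ ℚ_p` = BCS 2025 Thm 1.1.2 (a), `p`-parity}): at every
  `a = 2` door cell `2 ≤ s_p` (`two_le_selmerCorank_of_analyticRankTwo_of_door_of_facts`: `L(E,1) = 0 ⇒ s_p ≥ 1` by the tree
  THEOREM `one_le_selmerCorank_of_entireLFunction_one_eq_zero_of_mazurMainConjecture` below those two facts, `ρ̄` onto ⇒ `E[p]`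
  irreducible, then parity), so N1∣_door ⟺ «`a = 2 ⇒ s_p = 2` at door primes» = the ← half of `SelmerRankRankTwo` restricted to
  its own hypothesis block (`selCapTwoAtDoor_iff_selmerCorank_eq_two_of_facts`).

NET (for the planners).  Modulo print and the route's residual `PointsTwo`, the deciding crux S2 of route DerivedKatoValuationDoor
IS the ← half of the existing item `SelmerRankRankTwo` (0129 / 0483) = the first open cell (`a = 2`, `s_p ≥ 4` excluded) of
`SelmerRankUB` (0130 / 0484); every kernel theorem here is a by-name edge, and NOTHING is proved about N1∣_door, S2, 0129, 0130,
0489 or BSD.  Conditional theorems carry their named-fact hypotheses in the signature (D-0014).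

References: [cite: DokchitserDokchitserAnnals2010, Thm. 1.4]; [cite: BurungaleCastellaSkinner2025, Thm. 1.1.2 (a)];
[cite: GreenbergLNM1716, §1 (pp. 63–66) and Thm. 4.1]; [cite: Kato2004Asterisque, Thm. 18.4 (p. 281)]; [cite: Serre1972, §4.4 Thm. 2];
[cite: KuriharaPollack2007, §1.4 Lemma 1.4]; [cite: PerrinRiou1993AIF, Lemme 2.3.9 (p. 967)]; [cite: CastellaHsieh2022, Conj. 1.2 and Thm. A]
(the ← half of RankTwo is Darmon–Rotger's (4) ⇒ (2), open).
-/

set_option linter.dupNamespace false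
set_option autoImplicit false

noncomputable section

open scoped Classical

namespace Summit.BirchSwinnertonDyer.BirchSwinnertonDyer.Theorems.DerivedKatoValuationDoor

open Field
open Literature Literature.NumberTheory.GaloisRepresentations
open Literature.NumberTheory.EllipticCurves Literature.NumberTheory.EllipticCurves.ModularForms
open Literature.NumberTheory.EllipticCurves.Kato2004
open Literature.NumberTheory.EllipticCurves.Kato2004.EulerSystemValues
open CongruenceSubgroup
open Summit.BirchSwinnertonDyer.BirchSwinnertonDyer.Theses.DerivedKatoValuationDoor
  (CrisAtDoorPrimes PointsTwo IntegralH1RankLeTwoOfAnalyticRankTwo)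
open Summit.BirchSwinnertonDyer.BirchSwinnertonDyer.Theses.SelmerRank
  (SelmerRankUB SelmerRankRankTwo SelmerRankUBR2 SelmerRankRankTwoR2)
open Summit.BirchSwinnertonDyer.BirchSwinnertonDyer.Theses.PAdicOrderV2 (PAdicOrderComparisonR2)

/-! ## §1 Transfer down from the SelmerRank node items (unconditional, by name) -/

/-- **N1∣_door ⟸ `SelmerRankUB` (stmt-BirchSwinnertonDyer-0130) BY NAME**: the research stub is literally the `a = 2`
slice of the S0 node «`s_p ≤ a` at big-image good ordinary `p ≥ 5`» (door = `5 ≤ p ∧ IsOrdinaryAt ∧ ρ̄ onto`, and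
`IsOrdinaryAt W p ↔ good ∧ p ∤ a_p`).  Unconditional; `SelmerRankUB` is OPEN. [cite: Kato2004Asterisque, Thm. 18.4 (p. 281)] -/
theorem selCapTwoAtDoor_of_selmerRankUB (hUB : SelmerRankUB) :
    ∀ (W : WeierstrassCurve ℚ) [W.IsElliptic] [W.IsGloballyMinimal] (p : ℕ) [Fact p.Prime],
      W.analyticRank = 2 →
        (5 ≤ p ∧ Literature.NumberTheory.EllipticCurves.IsOrdinaryAt W p ∧ W.HasSurjectiveModNGaloisRep p) →
          W.selmerCorank p ≤ 2 := by
  intro W _ _ p _ ha hdoor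
  obtain ⟨h5, hord, hsurj⟩ := hdoor
  have hgo := (isOrdinaryAt_iff W p).1 hord
  have h := hUB W p h5 hgo.1 hgo.2 hsurj
  omega

/-- **N1∣_door ⟸ `SelmerRankRankTwo` (stmt-BirchSwinnertonDyer-0129) BY NAME** — only its ← half «`a = 2 ⇒ s_p = 2`» is used.
Unconditional; `SelmerRankRankTwo` is OPEN (its ← half is Darmon–Rotger's Conj. 1.2 (4) ⇒ (2)). [cite: CastellaHsieh2022, Conj. 1.2] -/
theorem selCapTwoAtDoor_of_selmerRankRankTwo (h2 : SelmerRankRankTwo) :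
    ∀ (W : WeierstrassCurve ℚ) [W.IsElliptic] [W.IsGloballyMinimal] (p : ℕ) [Fact p.Prime],
      W.analyticRank = 2 →
        (5 ≤ p ∧ Literature.NumberTheory.EllipticCurves.IsOrdinaryAt W p ∧ W.HasSurjectiveModNGaloisRep p) →
          W.selmerCorank p ≤ 2 := by
  intro W _ _ p _ ha hdoor
  obtain ⟨h5, hord, hsurj⟩ := hdoor
  have hgo := (isOrdinaryAt_iff W p).1 hord
  exact ((h2 W p h5 hgo.1 hgo.2 hsurj).2 ha).le

/-- The R2 copies of the two SelmerRank items (stmt-BirchSwinnertonDyer-0484 / 0483) are definitionally the originals. [folklore] -/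
theorem selmerRankUBR2_iff : SelmerRankUBR2 ↔ SelmerRankUB := Iff.rfl

/-- See `selmerRankUBR2_iff`. [folklore] -/
theorem selmerRankRankTwoR2_iff : SelmerRankRankTwoR2 ↔ SelmerRankRankTwo := Iff.rfl

/-- **The crux S2 BY NAME from `SelmerRankUB`**, modulo {ε-free dictionary `rank_kummerIntegralH1_eq_selmerCorank`, [KP07 1.4],
the route's residual `PointsTwo`} (through g3's `integralH1RankLeTwoOfAnalyticRankTwo_iff_selCapTwoAtDoor_of_facts`).  CONDITIONAL;
credits nothing. [cite: KuriharaPollack2007, §1.4 Lemma 1.4] [cite: PerrinRiou1993AIF, Lemme 2.3.9 (p. 967)] -/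
theorem integralH1RankLeTwoOfAnalyticRankTwo_of_selmerRankUB_of_facts
    (hSel : PerrinRiou1993.rank_kummerIntegralH1_eq_selmerCorank)
    (hKP : KuriharaPollack2007.lemma14_locP_image_rankOne) (hPts : PointsTwo) (hUB : SelmerRankUB) :
    IntegralH1RankLeTwoOfAnalyticRankTwo :=
  (integralH1RankLeTwoOfAnalyticRankTwo_iff_selCapTwoAtDoor_of_facts hSel hKP hPts).2
    (selCapTwoAtDoor_of_selmerRankUB hUB)

/-- **The crux S2 BY NAME from `SelmerRankRankTwo`**, modulo the same three inputs.  CONDITIONAL; credits nothing.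
[cite: KuriharaPollack2007, §1.4 Lemma 1.4] [cite: PerrinRiou1993AIF, Lemme 2.3.9 (p. 967)] -/
theorem integralH1RankLeTwoOfAnalyticRankTwo_of_selmerRankRankTwo_of_facts
    (hSel : PerrinRiou1993.rank_kummerIntegralH1_eq_selmerCorank)
    (hKP : KuriharaPollack2007.lemma14_locP_image_rankOne) (hPts : PointsTwo) (h2 : SelmerRankRankTwo) :
    IntegralH1RankLeTwoOfAnalyticRankTwo :=
  (integralH1RankLeTwoOfAnalyticRankTwo_iff_selCapTwoAtDoor_of_facts hSel hKP hPts).2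
    (selCapTwoAtDoor_of_selmerRankRankTwo h2)

/-- **`SelmerRankUB` ALONE gives this route's non-CM Tate face at analytic rank two** («`¬ CM ∧ a = 2 ⇒ r ≤ 2`»), unconditionally
in that one open hypothesis (g3's `mordellWeilRank_le_two_of_selCapTwoAtDoor`: door prime by Serre + good ordinary density, `r ≤ s_p`).
[cite: Serre1972, §4.4 Thm. 2] [cite: GreenbergLNM1716, §1 (pp. 54–57)] -/
theorem mordellWeilRank_le_two_of_selmerRankUB (hUB : SelmerRankUB) (W : WeierstrassCurve ℚ) [W.IsElliptic]
    (hcm : ¬ W.HasCM) (ha : W.analyticRank = 2) : W.mordellWeilRank ≤ 2 :=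
  mordellWeilRank_le_two_of_selCapTwoAtDoor (selCapTwoAtDoor_of_selmerRankUB hUB) W hcm ha

/-! ## §2 Transfer down from the `p`-adic order node (modulo Kato 18.4 and modularity) -/

/-- **N2∣_door ⟸ `PAdicOrderComparisonR2` (stmt-BirchSwinnertonDyer-0489) BY NAME**: the MTT order comparison `ord_T L_p(f, α_p) = a`
at every good ordinary `p` gives `ord_T L_p ≤ 2` at every door cell with `a = 2`, for every newform.  Unconditional; 0489 is OPEN.
[cite: MazurTateTeitelbaum1986Invent, §II.10] -/
theorem ordCapTwoAtDoor_of_pAdicOrderComparisonR2 (hR2 : PAdicOrderComparisonR2) :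
    ∀ (W : WeierstrassCurve ℚ) [W.IsElliptic] [W.IsGloballyMinimal] (p : ℕ) [Fact p.Prime],
      W.analyticRank = 2 →
        (5 ≤ p ∧ Literature.NumberTheory.EllipticCurves.IsOrdinaryAt W p ∧ W.HasSurjectiveModNGaloisRep p) →
          ∀ {N : ℕ} [NeZero N] (f : CuspForm (Gamma0 N) 2), IsNewformOf W f →
            (padicLFunction f (unitRoot W p : ℚ_[p])).order ≤ 2 := by
  intro W _ _ p _ ha hdoor N _ f hf
  rw [hR2 W p hdoor.2.1 f hf, ha]
  norm_num

/-- **N1∣_door ⟸ `PAdicOrderComparisonR2` modulo {Kato Thm. 18.4 `kato_selmerCorank_le_order_padicLFunction`, modularity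
`exists_isNewformOf`}** (via N2∣_door, g3's `selCapTwoAtDoor_of_ordCapTwoAtDoor_of_facts`).  CONDITIONAL; credits nothing.
[cite: Kato2004Asterisque, Thm. 18.4 (p. 281)] [cite: BreuilConradDiamondTaylor2001, Thm. A] -/
theorem selCapTwoAtDoor_of_pAdicOrderComparisonR2_of_facts
    (hKato : ∀ (W : WeierstrassCurve ℚ) [W.IsElliptic] [W.IsGloballyMinimal] (p : ℕ) [Fact p.Prime]
      {N : ℕ} [NeZero N] (f : CuspForm (Gamma0 N) 2), kato_selmerCorank_le_order_padicLFunction W p (f := f))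
    (hMod : exists_isNewformOf) (hR2 : PAdicOrderComparisonR2) :
    ∀ (W : WeierstrassCurve ℚ) [W.IsElliptic] [W.IsGloballyMinimal] (p : ℕ) [Fact p.Prime],
      W.analyticRank = 2 →
        (5 ≤ p ∧ Literature.NumberTheory.EllipticCurves.IsOrdinaryAt W p ∧ W.HasSurjectiveModNGaloisRep p) →
          W.selmerCorank p ≤ 2 :=
  selCapTwoAtDoor_of_ordCapTwoAtDoor_of_facts hKato hMod (ordCapTwoAtDoor_of_pAdicOrderComparisonR2 hR2)

/-! ## §3 Parity: N1∣_door ⟺ «`s_p ≤ 3`», and the shape of a failure -/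

section Parity

variable (W : WeierstrassCurve ℚ) (p : ℕ)

/-- **Parity gap at one cell**: modulo the `p`-parity fact `selmerCorank_mod_two_eq W p` (`s_p ≡ a (mod 2)`), at an
analytic-rank-two curve `s_p ≤ 3` already forces `s_p ≤ 2`.  CONDITIONAL on the named fact. [cite: DokchitserDokchitserAnnals2010, Thm. 1.4] -/
theorem selmerCorank_le_two_of_le_three_of_parity (hpar : selmerCorank_mod_two_eq W p)
    (ha : W.analyticRank = 2) (h3 : W.selmerCorank p ≤ 3) : W.selmerCorank p ≤ 2 := by
  have hp : W.selmerCorank p % 2 = W.analyticRank % 2 := hpar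
  rw [ha] at hp
  omega

/-- **A failure overshoots by two**: modulo `p`-parity, at an analytic-rank-two curve `¬ s_p ≤ 2` means `4 ≤ s_p`.
CONDITIONAL on the named fact. [cite: DokchitserDokchitserAnnals2010, Thm. 1.4] -/
theorem four_le_selmerCorank_of_not_le_two_of_parity (hpar : selmerCorank_mod_two_eq W p)
    (ha : W.analyticRank = 2) (h : ¬ W.selmerCorank p ≤ 2) : 4 ≤ W.selmerCorank p := by
  have hp : W.selmerCorank p % 2 = W.analyticRank % 2 := hpar
  rw [ha] at hp
  omega

end Parity

/-- **STRENGTHEN lens: N1∣_door ⟺ the a-priori weaker cap «`a = 2 ⇒ s_p ≤ 3` at door primes»**, modulo `p`-parity at every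
elliptic `W/ℚ` and prime.  So any mechanism excluding ONE unit of excess (`s_p = 3` is impossible anyway) closes the stub; the first
value a proof must exclude is `s_p = 4`.  CONDITIONAL; neither side is proved. [cite: DokchitserDokchitserAnnals2010, Thm. 1.4] -/
theorem selCapTwoAtDoor_iff_selCapThreeAtDoor_of_parity
    (hpar : ∀ (W : WeierstrassCurve ℚ) [W.IsElliptic] (p : ℕ) [Fact p.Prime], selmerCorank_mod_two_eq W p) :
    (∀ (W : WeierstrassCurve ℚ) [W.IsElliptic] [W.IsGloballyMinimal] (p : ℕ) [Fact p.Prime],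
      W.analyticRank = 2 →
        (5 ≤ p ∧ Literature.NumberTheory.EllipticCurves.IsOrdinaryAt W p ∧ W.HasSurjectiveModNGaloisRep p) →
          W.selmerCorank p ≤ 2) ↔
    ∀ (W : WeierstrassCurve ℚ) [W.IsElliptic] [W.IsGloballyMinimal] (p : ℕ) [Fact p.Prime],
      W.analyticRank = 2 →
        (5 ≤ p ∧ Literature.NumberTheory.EllipticCurves.IsOrdinaryAt W p ∧ W.HasSurjectiveModNGaloisRep p) →
          W.selmerCorank p ≤ 3 := by
  constructor
  · intro h W _ _ p _ ha hdoor
    exact (h W p ha hdoor).trans (by norm_num)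
  · intro h W _ _ p _ ha hdoor
    exact selmerCorank_le_two_of_le_three_of_parity W p (hpar W p) ha (h W p ha hdoor)

/-- **NEGATION lens: what a counterexample to N1∣_door must be**, modulo `p`-parity: a globally minimal analytic-rank-two `W/ℚ`
and a door prime `p` with `4 ≤ s_p`, i.e. (Greenberg's identity, tree theorem `selmerCorank_eq_mordellWeilRank_add_holds`)
`4 ≤ rank E(ℚ) + corank Ш(E)[p^∞]` — under BSD-rank (`r = 2`) a `Ш[p^∞]` of corank ≥ 2 at a big-image good ordinary prime.
CONDITIONAL; no such curve is known. [cite: DokchitserDokchitserAnnals2010, Thm. 1.4] [cite: GreenbergLNM1716, §1 (p. 53)] -/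
theorem not_selCapTwoAtDoor_iff_of_parity
    (hpar : ∀ (W : WeierstrassCurve ℚ) [W.IsElliptic] (p : ℕ) [Fact p.Prime], selmerCorank_mod_two_eq W p) :
    (¬ ∀ (W : WeierstrassCurve ℚ) [W.IsElliptic] [W.IsGloballyMinimal] (p : ℕ) [Fact p.Prime],
      W.analyticRank = 2 →
        (5 ≤ p ∧ Literature.NumberTheory.EllipticCurves.IsOrdinaryAt W p ∧ W.HasSurjectiveModNGaloisRep p) →
          W.selmerCorank p ≤ 2) ↔
    ∃ (W : WeierstrassCurve ℚ) (_ : W.IsElliptic) (_ : W.IsGloballyMinimal) (p : ℕ) (_ : Fact p.Prime),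
      W.analyticRank = 2 ∧
        (5 ≤ p ∧ Literature.NumberTheory.EllipticCurves.IsOrdinaryAt W p ∧ W.HasSurjectiveModNGaloisRep p) ∧
          4 ≤ W.selmerCorank p ∧ 4 ≤ W.mordellWeilRank + W.shaCorank p := by
  constructor
  · intro h
    by_contra hne
    apply h
    intro W _ _ p _ ha hdoor
    by_contra hle
    have h4 := four_le_selmerCorank_of_not_le_two_of_parity W p (hpar W p) ha hle
    have hid := W.selmerCorank_eq_mordellWeilRank_add_holds p
    exact hne ⟨W, ‹_›, ‹_›, p, ‹_›, ha, hdoor, h4, by omega⟩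
  · rintro ⟨W, _, _, p, _, ha, hdoor, h4, -⟩ h
    have := h W p ha hdoor
    omega

/-! ## §4 Exactness: at an `a = 2` door cell `2 ≤ s_p` (modulo print), so N1∣_door says `s_p = 2` -/

/-- **Lower bound at a door cell, modulo print**: GIVEN modularity `exists_isNewformOf`, Mazur's main conjecture in `Λ ⊗ ℚ_p`
(`burungale_castella_skinner_charIdeal_eq_padicLFunction`, BCS 2025 Thm 1.1.2 (a)) and `p`-parity `selmerCorank_mod_two_eq`, every
globally minimal analytic-rank-two `W/ℚ` has `2 ≤ s_p` at every door prime: `a = 2 ⇒ L(E,1) = 0`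
(`analyticRank_eq_zero_of_entireLFunction_one_ne_zero`) ⇒ `1 ≤ s_p` by the tree theorem
`one_le_selmerCorank_of_entireLFunction_one_eq_zero_of_mazurMainConjecture` (`E[p]` irreducible because `ρ̄_{E,p}` is onto,
`hasIrreducibleModPGaloisRep_of_hasSurjectiveModNGaloisRep`), and `s_p` is even.  CONDITIONAL on the three named facts.
[cite: BurungaleCastellaSkinner2025, Thm. 1.1.2 (a)] [cite: GreenbergLNM1716, §1 (pp. 65–66) and Thm. 4.1]
[cite: DokchitserDokchitserAnnals2010, Thm. 1.4] -/
theorem two_le_selmerCorank_of_analyticRankTwo_of_door_of_facts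
    (hmod : exists_isNewformOf) (hMC : burungale_castella_skinner_charIdeal_eq_padicLFunction)
    (hpar : ∀ (W : WeierstrassCurve ℚ) [W.IsElliptic] (p : ℕ) [Fact p.Prime], selmerCorank_mod_two_eq W p)
    (W : WeierstrassCurve ℚ) [W.IsElliptic] [W.IsGloballyMinimal] (p : ℕ) [Fact p.Prime] (ha : W.analyticRank = 2)
    (hdoor : 5 ≤ p ∧ Literature.NumberTheory.EllipticCurves.IsOrdinaryAt W p ∧ W.HasSurjectiveModNGaloisRep p) :
    2 ≤ W.selmerCorank p := by
  obtain ⟨h5, hord, hsurj⟩ := hdoor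
  have hgo := (isOrdinaryAt_iff W p).1 hord
  have hirr : W.HasIrreducibleModPGaloisRep p :=
    hasIrreducibleModPGaloisRep_of_hasSurjectiveModNGaloisRep W p hsurj
  have hL : W.entireLFunction 1 = 0 := by
    by_contra hne
    have h0 := analyticRank_eq_zero_of_entireLFunction_one_ne_zero W hne
    omega
  have h1 : 1 ≤ W.selmerCorank p :=
    one_le_selmerCorank_of_entireLFunction_one_eq_zero_of_mazurMainConjecture hmod hMC W p h5 hgo.1 hgo.2
      hirr hL
  have hp : W.selmerCorank p % 2 = W.analyticRank % 2 := hpar W p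
  rw [ha] at hp
  omega

/-- **EXACTNESS: N1∣_door ⟺ «`a = 2 ⇒ s_p = 2` at door primes»** (= the ← half of `SelmerRankRankTwo`, stmt-0129, restricted to the
door hypothesis block), modulo {modularity, Mazur's main conjecture (BCS 1.1.2 (a)), `p`-parity}.  CONDITIONAL; neither side is proved.
[cite: BurungaleCastellaSkinner2025, Thm. 1.1.2 (a)] [cite: DokchitserDokchitserAnnals2010, Thm. 1.4] [cite: CastellaHsieh2022, Conj. 1.2] -/
theorem selCapTwoAtDoor_iff_selmerCorank_eq_two_of_facts
    (hmod : exists_isNewformOf) (hMC : burungale_castella_skinner_charIdeal_eq_padicLFunction)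
    (hpar : ∀ (W : WeierstrassCurve ℚ) [W.IsElliptic] (p : ℕ) [Fact p.Prime], selmerCorank_mod_two_eq W p) :
    (∀ (W : WeierstrassCurve ℚ) [W.IsElliptic] [W.IsGloballyMinimal] (p : ℕ) [Fact p.Prime],
      W.analyticRank = 2 →
        (5 ≤ p ∧ Literature.NumberTheory.EllipticCurves.IsOrdinaryAt W p ∧ W.HasSurjectiveModNGaloisRep p) →
          W.selmerCorank p ≤ 2) ↔
    ∀ (W : WeierstrassCurve ℚ) [W.IsElliptic] [W.IsGloballyMinimal] (p : ℕ) [Fact p.Prime],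
      W.analyticRank = 2 →
        (5 ≤ p ∧ Literature.NumberTheory.EllipticCurves.IsOrdinaryAt W p ∧ W.HasSurjectiveModNGaloisRep p) →
          W.selmerCorank p = 2 := by
  constructor
  · intro h W _ _ p _ ha hdoor
    exact le_antisymm (h W p ha hdoor) (two_le_selmerCorank_of_analyticRankTwo_of_door_of_facts hmod hMC hpar W p ha hdoor)
  · intro h W _ _ p _ ha hdoor
    exact (h W p ha hdoor).le

/-- **The ← half of `SelmerRankRankTwo` on its own hypothesis block, from N1∣_door modulo the same three facts** — spelled out (not
stated as the item 0129 itself, whose → half «`s_p = 2 ⇒ a = 2`» is untouched here).  CONDITIONAL; credits nothing.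
[cite: BurungaleCastellaSkinner2025, Thm. 1.1.2 (a)] [cite: DokchitserDokchitserAnnals2010, Thm. 1.4] -/
theorem rankTwo_mpr_of_selCapTwoAtDoor_of_facts
    (hmod : exists_isNewformOf) (hMC : burungale_castella_skinner_charIdeal_eq_padicLFunction)
    (hpar : ∀ (W : WeierstrassCurve ℚ) [W.IsElliptic] (p : ℕ) [Fact p.Prime], selmerCorank_mod_two_eq W p)
    (hN1 : ∀ (W : WeierstrassCurve ℚ) [W.IsElliptic] [W.IsGloballyMinimal] (p : ℕ) [Fact p.Prime],
      W.analyticRank = 2 →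
        (5 ≤ p ∧ Literature.NumberTheory.EllipticCurves.IsOrdinaryAt W p ∧ W.HasSurjectiveModNGaloisRep p) →
          W.selmerCorank p ≤ 2) :
    ∀ (W : WeierstrassCurve ℚ) [W.IsElliptic] [W.IsGloballyMinimal] (p : ℕ) [Fact p.Prime], 5 ≤ p →
      W.HasGoodReductionAtPrime p → ¬ (p : ℤ) ∣ W.frobeniusTrace p → W.HasSurjectiveModNGaloisRep p →
        W.analyticRank = 2 → W.selmerCorank p = 2 := by
  intro W _ _ p _ h5 hgood hord hsurj ha
  have hdoor : 5 ≤ p ∧ Literature.NumberTheory.EllipticCurves.IsOrdinaryAt W p ∧ W.HasSurjectiveModNGaloisRep p :=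
    ⟨h5, (isOrdinaryAt_iff W p).2 ⟨hgood, hord⟩, hsurj⟩
  exact (selCapTwoAtDoor_iff_selmerCorank_eq_two_of_facts hmod hMC hpar).1 hN1 W p ha hdoor

/-- **Conversely (unconditional): the ← half of `SelmerRankRankTwo` on the door block gives N1∣_door** — so, modulo
{modularity, BCS 1.1.2 (a), `p`-parity}, N1∣_door and «`a = 2 ⇒ s_p = 2` at big-image good ordinary `p ≥ 5`» are the SAME statement
(`rankTwo_mpr_of_selCapTwoAtDoor_of_facts` for the other direction). [folklore] -/
theorem selCapTwoAtDoor_of_rankTwo_mpr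
    (hmpr : ∀ (W : WeierstrassCurve ℚ) [W.IsElliptic] [W.IsGloballyMinimal] (p : ℕ) [Fact p.Prime], 5 ≤ p →
      W.HasGoodReductionAtPrime p → ¬ (p : ℤ) ∣ W.frobeniusTrace p → W.HasSurjectiveModNGaloisRep p →
        W.analyticRank = 2 → W.selmerCorank p = 2) :
    ∀ (W : WeierstrassCurve ℚ) [W.IsElliptic] [W.IsGloballyMinimal] (p : ℕ) [Fact p.Prime],
      W.analyticRank = 2 →
        (5 ≤ p ∧ Literature.NumberTheory.EllipticCurves.IsOrdinaryAt W p ∧ W.HasSurjectiveModNGaloisRep p) →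
          W.selmerCorank p ≤ 2 := by
  intro W _ _ p _ ha hdoor
  obtain ⟨h5, hord, hsurj⟩ := hdoor
  have hgo := (isOrdinaryAt_iff W p).1 hord
  exact (hmpr W p h5 hgo.1 hgo.2 hsurj ha).le

end Summit.BirchSwinnertonDyer.BirchSwinnertonDyer.Theorems.DerivedKatoValuationDoor

end
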